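import Summits.Parity.GeneralizedHardyLittlewood.Theorems.PrimeLevelFamEdgeIdeaDeltasWucLadderDefs
import HarnessLib

/-!
# Route `PrimeLevelFamEdge` — TYPED IDEA DELTAS, deck 11′: `wuc` ladder add-on J1 (cell ls-idea, seat
# ls-idea-lens-13, cards §J1; LANDING NOTE typer gen 2: the seat's `WucLadder_J1_addon.lean` sha16
# bd100bd578c02016 VERBATIM, docstrings added): «SOME sub-power minorant exists» ≡ Siegel.

Imports typ-1's landed deck 11 (`PrimeLevelFamEdgeIdeaDeltasWucLadderDefs`, p598666) and adds, over its
`LOneShape`/`lOneShape_rpow_neg`: `SubPower g`, `lOneShape_of_subPower_minorant`,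
`exists_subPower_minorant`, `exists_subPower_minorant_iff`, `exists_subPower_minorant_siegel`.
READING: on the ∃-rail sub-power-ness per se is in tree (ineffective); the open content of
`RootExpRung κ` / `SubPowerRung θ` / `DivisorLossRung C` is only the FIXED SHAPE.
Kernel bookkeeping over Siegel's in-tree theorem; nothing here is an exceptional-zero theorem.
-/

noncomputable section

namespace Summit.Parity.GeneralizedHardyLittlewood.Theorems.PrimeLevelFamEdgeIdeaDeltas.Wuc

/-! ### J1 — «there is SOME sub-power minorant» is Siegel's theorem itself (in-tree, trivially)

The content of a sub-power rung is its FIXED SHAPE (regularity of the decay), not sub-power-ness: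
the existence of *some* shape `g` decaying slower than every power with `LOneShape g` is
equivalent to the conjunction of the power shapes, i.e. to Siegel's theorem, hence a tree theorem. -/

/-- `g` decays slower than every power of `D` (on `D ≥ 3`): `∀ ε > 0, ∃ c > 0, c·D^{−ε} ≤ g(D)`.
A PREDICATE in `g`. [cite: MontgomeryVaughan2007, Thm. 11.14 (Siegel; context)] -/
def SubPower (g : ℕ → ℝ) : Prop :=
  ∀ ε : ℝ, 0 < ε → ∃ c : ℝ, 0 < c ∧ ∀ D : ℕ, 3 ≤ D → c * (D : ℝ) ^ (-ε) ≤ g D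

/-- A sub-power minorant below `‖L(1,χ_D)‖` gives every power shape (proved). [cite: MontgomeryVaughan2007, Thm. 11.14] -/
theorem lOneShape_of_subPower_minorant {g : ℕ → ℝ} (hg : SubPower g) (h : LOneShape g)
    {ε : ℝ} (hε : 0 < ε) : LOneShape (fun D => (D : ℝ) ^ (-ε)) := by
  obtain ⟨c, hc, hcg⟩ := hg ε hε
  obtain ⟨c₀, hc₀, h⟩ := h
  refine ⟨c₀ * c, mul_pos hc₀ hc, fun D _ χ hD hq hp => ?_⟩
  have h1 := h D χ hD hq hp
  have h2 : c₀ * (c * (D : ℝ) ^ (-ε)) ≤ c₀ * g D := mul_le_mul_of_nonneg_left (hcg D hD) hc₀.le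
  calc c₀ * c * (D : ℝ) ^ (-ε) = c₀ * (c * (D : ℝ) ^ (-ε)) := by ring
    _ ≤ c₀ * g D := h2
    _ < ‖χ.LFunction 1‖ := h1

/-- The (ineffective) minorant extracted from the power shapes: a countable sup of clipped power
shapes `min(C_n,1)/2 · D^{-1/(n+1)}`, `C_n` the Siegel constant at `ε = 1/(n+1)` (chosen by AC). PROVED.
[cite: MontgomeryVaughan2007, Thm. 11.14 (Siegel)] -/
theorem exists_subPower_minorant (h : ∀ ε : ℝ, 0 < ε → LOneShape (fun D => (D : ℝ) ^ (-ε))) :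
    ∃ g : ℕ → ℝ, SubPower g ∧ LOneShape g := by
  classical
  have hpos : ∀ n : ℕ, (0 : ℝ) < 1 / ((n : ℝ) + 1) := fun n => by positivity
  choose C hC hCL using fun n : ℕ => h (1 / ((n : ℝ) + 1)) (hpos n)
  -- the clipped terms
  let t : ℕ → ℕ → ℝ := fun D n => min (C n) 1 / 2 * (D : ℝ) ^ (-(1 / ((n : ℝ) + 1)))
  have ht_le : ∀ D : ℕ, 1 ≤ D → ∀ n, t D n ≤ 1 / 2 := by
    intro D hD n
    have hD1 : (1 : ℝ) ≤ D := by exact_mod_cast hD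
    have hr : (D : ℝ) ^ (-(1 / ((n : ℝ) + 1))) ≤ 1 :=
      Real.rpow_le_one_of_one_le_of_nonpos hD1 (by have := hpos n; linarith)
    have hm : min (C n) 1 / 2 ≤ 1 / 2 := by
      have := min_le_right (C n) 1; linarith
    have hm0 : 0 ≤ min (C n) 1 / 2 := by
      have := lt_min (hC n) one_pos; linarith
    calc t D n = min (C n) 1 / 2 * (D : ℝ) ^ (-(1 / ((n : ℝ) + 1))) := rfl
      _ ≤ 1 / 2 * 1 := mul_le_mul hm hr (by positivity) (by norm_num)
      _ = 1 / 2 := by ring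
  have hbdd : ∀ D : ℕ, 1 ≤ D → BddAbove (Set.range (t D)) := fun D hD =>
    ⟨1 / 2, by rintro _ ⟨n, rfl⟩; exact ht_le D hD n⟩
  refine ⟨fun D => ⨆ n, t D n, ?_, ?_⟩
  · -- SubPower
    intro ε hε
    obtain ⟨n, hn⟩ := exists_nat_one_div_lt hε
    refine ⟨min (C n) 1 / 2, by have := lt_min (hC n) one_pos; positivity, fun D hD => ?_⟩
    have hD1 : (1 : ℝ) ≤ D := by exact_mod_cast (le_trans (by norm_num) hD : 1 ≤ D)
    have hm0 : 0 ≤ min (C n) 1 / 2 := by have := lt_min (hC n) one_pos; linarith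
    calc min (C n) 1 / 2 * (D : ℝ) ^ (-ε)
        ≤ min (C n) 1 / 2 * (D : ℝ) ^ (-(1 / ((n : ℝ) + 1))) := by
          apply mul_le_mul_of_nonneg_left _ hm0
          exact Real.rpow_le_rpow_of_exponent_le hD1 (by linarith)
      _ = t D n := rfl
      _ ≤ ⨆ m, t D m := le_ciSup (hbdd D (le_trans (by norm_num) hD)) n
  · -- LOneShape with c = 1
    refine ⟨1, one_pos, fun D _ χ hD hq hp => ?_⟩
    have hD1 : 1 ≤ D := le_trans (by norm_num) hD
    have hDpos : (0 : ℝ) < D := by exact_mod_cast (lt_of_lt_of_le one_pos hD1)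
    have hL : ∀ n, t D n < ‖χ.LFunction 1‖ / 2 := by
      intro n
      have h1 := hCL n D χ hD hq hp
      have hr : 0 < (D : ℝ) ^ (-(1 / ((n : ℝ) + 1))) := Real.rpow_pos_of_pos hDpos _
      have hm : min (C n) 1 / 2 ≤ C n / 2 := by have := min_le_left (C n) 1; linarith
      calc t D n = min (C n) 1 / 2 * (D : ℝ) ^ (-(1 / ((n : ℝ) + 1))) := rfl
        _ ≤ C n / 2 * (D : ℝ) ^ (-(1 / ((n : ℝ) + 1))) := mul_le_mul_of_nonneg_right hm hr.le
        _ = (C n * (D : ℝ) ^ (-(1 / ((n : ℝ) + 1)))) / 2 := by ring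
        _ < ‖χ.LFunction 1‖ / 2 := by linarith
    have hLpos : 0 < ‖χ.LFunction 1‖ := by
      have h1 := hCL 0 D χ hD hq hp
      have hr : 0 < (D : ℝ) ^ (-(1 / (((0 : ℕ) : ℝ) + 1))) := Real.rpow_pos_of_pos hDpos _
      have h2 : 0 < C 0 * (D : ℝ) ^ (-(1 / (((0 : ℕ) : ℝ) + 1))) := mul_pos (hC 0) hr
      linarith
    have hsup : (⨆ n, t D n) ≤ ‖χ.LFunction 1‖ / 2 := ciSup_le fun n => (hL n).le
    calc (1 : ℝ) * ⨆ n, t D n = ⨆ n, t D n := one_mul _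
      _ ≤ ‖χ.LFunction 1‖ / 2 := hsup
      _ < ‖χ.LFunction 1‖ := by linarith

/-- **J1.** «Some sub-power minorant exists» ↔ «every power shape holds» (Siegel); both in tree. PROVED.
[cite: MontgomeryVaughan2007, Thm. 11.14 (Siegel)] -/
theorem exists_subPower_minorant_iff :
    (∃ g : ℕ → ℝ, SubPower g ∧ LOneShape g) ↔
      ∀ ε : ℝ, 0 < ε → LOneShape (fun D => (D : ℝ) ^ (-ε)) :=
  ⟨fun ⟨_, hg, h⟩ _ hε => lOneShape_of_subPower_minorant hg h hε, exists_subPower_minorant⟩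

/-- Hence unconditionally (via `lOneShape_rpow_neg`): a sub-power minorant EXISTS — only its SHAPE
is unknown. PROVED (ineffective: Siegel + choice). [cite: MontgomeryVaughan2007, Thm. 11.14 (Siegel)] -/
theorem exists_subPower_minorant_siegel : ∃ g : ℕ → ℝ, SubPower g ∧ LOneShape g :=
  exists_subPower_minorant fun _ hε => lOneShape_rpow_neg hε

/-! ### J1′ — referee D's rule (b3) kernelised: the EXPLICIT rail also dies under existential closure

`∃ K D₀, GGZUniformRung K D₀` is a tree theorem (Siegel at `ε = 1/4` + `log D ≤ 4·D^{1/4}`), so an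
explicit-rail landing must instantiate `K`, `D₀` (resp. `ε` and the constant) by NUMERALS. -/

/-- **J1′ (referee D b3).** Existential closure of the weakest explicit rung is Siegel-vacuous:
`∃ K, GGZUniformRung K 3` — PROVED from the tree's Siegel theorem at `ε = 1/4` and `log D ≤ 4·D^{1/4}`
(so an explicit-rail landing must instantiate `K`, `D₀` by NUMERALS). Add-on v2 sha16 b712207edbb0a47d,
verbatim. [cite: MontgomeryVaughan2007, Thm. 11.14 (Siegel)] -/
theorem exists_ggzUniformRung_siegel : ∃ K : ℝ, GGZUniformRung K 3 := by
  obtain ⟨c, hc, h⟩ := lOneShape_rpow_neg (ε := 1 / 4) (by norm_num)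
  refine ⟨4 / c, le_refl 0, by positivity, fun D _ χ hD hq hp => ?_⟩
  have hD0 : (0 : ℝ) < D := by exact_mod_cast (lt_of_lt_of_le (by norm_num : 0 < 3) hD)
  have hlt : c * (D : ℝ) ^ (-(1 / 4 : ℝ)) < ‖χ.LFunction 1‖ := h D χ hD hq hp
  have hlog : Real.log D ≤ 4 * (D : ℝ) ^ (1 / 4 : ℝ) := by
    have := Real.log_le_rpow_div hD0.le (by norm_num : (0 : ℝ) < 1 / 4)
    linarith [this]
  have hsqrt : Real.sqrt D = (D : ℝ) ^ (1 / 2 : ℝ) := Real.sqrt_eq_rpow (D : ℝ)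
  have hsqrt_pos : 0 < Real.sqrt (D : ℝ) := Real.sqrt_pos.mpr hD0
  have h14 : (D : ℝ) ^ (1 / 4 : ℝ) = (D : ℝ) ^ (-(1 / 4 : ℝ)) * (D : ℝ) ^ (1 / 2 : ℝ) := by
    rw [← Real.rpow_add hD0]; norm_num
  have hden : 0 < 4 / c * Real.sqrt (D : ℝ) := by positivity
  calc Real.log D ^ ((1 : ℝ) + 0) / (4 / c * Real.sqrt D)
      = Real.log D / (4 / c * Real.sqrt D) := by norm_num
    _ ≤ 4 * (D : ℝ) ^ (1 / 4 : ℝ) / (4 / c * Real.sqrt D) :=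
        div_le_div_of_nonneg_right hlog hden.le
    _ = c * (D : ℝ) ^ (-(1 / 4 : ℝ)) := by
        rw [h14, hsqrt]
        have hr : 0 < (D : ℝ) ^ (1 / 2 : ℝ) := Real.rpow_pos_of_pos hD0 _
        field_simp
    _ ≤ ‖χ.LFunction 1‖ := hlt.le

end Summit.Parity.GeneralizedHardyLittlewood.Theorems.PrimeLevelFamEdgeIdeaDeltas.Wuc

end
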